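import Literature.Computability.QuantumComplexity.StabilizerNormalFormProofs
import Literature.LinearAlgebra.Subspace.GaussianBinomialProduct
import HarnessLib

/-!
# The number of stabilizer states — discharge of `AaronsonGottesman2004_prop2`
# (Aaronson–Gottesman 2004, Proposition 2)

Topic `Literature/Computability/QuantumComplexity`; second sibling proof file of
`StabilizerNormalForm.lean` (after `StabilizerNormalFormProofs.lean`, which proves the converse of
the normal form). It proves, sorry-free and over the tree's operational `stabilizerStates n` (the
orbit of `|0ⁿ⟩` under the monoid generated by placed `H`, `S`, `CNOT`), the named fact

* `AaronsonGottesman2004_prop2_holds` — S. Aaronson, D. Gottesman, *Improved simulation of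
  stabilizer circuits*, Phys. Rev. A 70 (2004) 052328, **Proposition 2** (read at the source,
  arXiv:quant-ph/0406196, §I, held text `paper:arxiv-quant-ph_0406196` p. 5): "Let `N` be the
  number of pure stabilizer states on `n` qubits. Then `N = 2ⁿ ∏_{k=0}^{n-1} (2^{n-k} + 1)`", in the
  tree's form: the set of lines `ℂψ`, `ψ ∈ stabilizerStates n`, has `ncard` equal to
  `2ⁿ ∏_{k<n} (2^{n-k} + 1)`.

## The printed proof and the road taken here

Printed (loc. cit.): `N = G/A` with `G = 2ⁿ ∏_k (4ⁿ/2^k − 2^k)` the number of signed generating sets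
of `n` commuting independent Paulis and `A = ∏_k (2ⁿ − 2^k)` the number of generating sets of one
stabilizer group — i.e. a count of stabilizer *groups*, resting on Theorem 1 (iii)–(iv) of the
paper (a state is a stabilizer state iff it is stabilized by exactly `2ⁿ` Pauli operators, and is
then determined by them). The tree's definition of stabilizer states is Theorem 1 (i) (Clifford
circuits applied to `|0ⁿ⟩`), and no Pauli-stabilizer-group formalism with this uniqueness theorem
exists in the tree or in Mathlib. The count is therefore run through the amplitude normal form that
the tree *does* have — this is the classical alternative derivation of the same number from the
Dehaene–De Moor description of stabilizer states (Dehaene–De Moor 2003, Thm. 5; Van den Nest 2010,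
§5; cf. D. Gross, J. Math. Phys. 47 (2006) 122107 for the analogous count in odd dimension):

1. **Lines ↔ directions** (`lineSet_eq_image`, `ncard_stabVecs_eq`). By the tree's normal form
   `ApproxRankTypical.repr_of_mem_stabilizerStates` every stabilizer state is `c · v`,
   `v = (x ↦ [x ∈ S] i^{p(x)})` with `S` a non-empty affine subspace of `𝔽₂ⁿ` (written as a
   *support* `supp Z x₀ = {x : f(x) = f(x₀) ∀ f ∈ Z}`, `Z` a space of functionals) and `p` a
   quadratic phase function; conversely (`StabilizerNormalForm.exists_smul_stabilizer_ddm`, the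
   discharge of `VanDenNest2010_expansion_converse`) every such *direction* `v ∈ stabVecs n` is a
   non-zero multiple of a stabilizer state. Two directions span the same line iff they differ by a
   phase `i^j` (`exists_eq_phase_smul`), so `#stabVecs = 4 · #lines`.
2. **Directions with a given support** (`ncard_qfOn_supp`, `ncard_qfSet`). On a support of
   dimension `d` the restricted phase functions correspond, through affine coordinates `𝔽₂ᵈ ≅ S`
   and an affine retraction (`LinearMap.exists_leftInverse_of_injective`), to the quadratic phase
   functions on `d` bits, of which there are `4^{d+1} 2^{d(d-1)/2}` (splitting along the last bit:
   `QF_{d+1} ≅ QF_d × {e + 2Σ[μᵢ][yᵢ]}`, using the tree's `IsQF.flip_diff`).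
3. **Summing over the supports** (`card_svF_eq`). The supports of a fixed `Z` are its `2ⁿ/2^d`
   cosets (`card_suppsOf_mul`), `d = dim Z^⊥ = n − dim Z`; distinct `Z` have distinct supports
   (`eq_of_supp_eq`, `Z = (Z^⊥)⁰`). Hence `#stabVecs = Σ_Z 2^{n-d} 4^{d+1} 2^{C(d,2)}
   = 4 · 2ⁿ Σ_Z 2^{C(codim Z + 1, 2)}`, the sum over all subspaces `Z` of the dual of `𝔽₂ⁿ`.
4. **The lattice count** (`sum_allZ_pow`): `Σ_Z 2^{C(codim Z + 1, 2)} = ∏_{i=1}^{n} (1 + 2^i)`, the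
   `q`-binomial theorem at `q = z = 2`, proved in `Literature.LinearAlgebra.Subspace`
   (`sum_pow_choose_succ_mul_card_codim`, from the recursion of `MoebiusCount.lean`). Reindexing
   `∏_{i=1}^{n} (2^i + 1) = ∏_{k<n} (2^{n-k} + 1)` gives Proposition 2.

## Main declarations (namespace `StabilizerNormalForm`)

* `isQF_comp`, `qfSet`, `ncard_qfSet` — quadratic phase functions on `k` bits and their number;
* `supp`, `ncard_supp`, `eq_of_supp_eq`, `restrict0`, `qfOn`, `ncard_qfOn_supp` — supports;
* `stabVec`, `stabVecs`, `lineSet`, `lineSet_eq_image`, `exists_eq_phase_smul`, `ncard_stabVecs_eq`;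
* `allZ`, `suppsOf`, `supports`, `qfF`, `qfOnF`, `svF`, `card_svF`, `card_svF_eq` — bookkeeping;
* `AaronsonGottesman2004_prop2_holds` (root namespace of the topic) — the discharge.

## References

* S. Aaronson, D. Gottesman, *Improved simulation of stabilizer circuits*, Phys. Rev. A 70 (2004)
  052328, arXiv:quant-ph/0406196, Theorem 1 and Proposition 2 with its proof. [AaronsonGottesman2004]
* J. Dehaene, B. De Moor, *Clifford group, stabilizer states, and linear and quadratic operations
  over GF(2)*, Phys. Rev. A 68 (2003) 042318, Thm. 5. [DehaeneDemoor2003]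
* M. Van den Nest, *Classical simulation of quantum computation, the Gottesman–Knill theorem, and
  slightly beyond*, Quantum Inf. Comput. 10 (2010) 258–271, §5 eq. (3). [Vandennest2010]
* G. E. Andrews, *The theory of partitions* (1976), Thm. 3.3 (the `q`-binomial theorem).

## Design notes

* Supports are parametrised by spaces of functionals `Z ≤ (𝔽₂ⁿ)*` and base points rather than by
  Mathlib affine subspaces: the dimension of a support is then the *codimension* of `Z`, which is
  the grading in which `Literature.LinearAlgebra.Subspace` counts subspaces.
* All sets are finite; `Finset` versions (`allZ`, `svF`, …) are used for the fibrewise sums and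
  `Set.ncard` for the bijections; decidability is classical throughout the counting section.
-/

noncomputable section

namespace Literature.Computability.QuantumComplexity

open _root_.Computability Cryptography Matrix Finset Module
open ApproxRankTypical

namespace StabilizerNormalForm

variable {n : ℕ}

/-! ### Quadratic phase functions under affine maps between registers of different sizes -/

/-- Quadratic phase functions are closed under coordinatewise-affine substitutions
`σ : 𝔽₂ᵏ → 𝔽₂ᵐ` (the tree's `IsQF.comp`, for registers of different sizes). [folklore] -/
theorem isQF_comp {m k : ℕ} {p : QReg m → ZMod 4} (hp : IsQF p) (σ : QReg k → QReg m)
    (hσ : ∀ i, IsAffB (fun y => σ y i)) : IsQF (fun y => p (σ y)) := by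
  obtain ⟨c, l, q, hp⟩ := hp
  have h1 : IsQF (fun y : QReg k => ∑ i, l i * bq (σ y i)) :=
    IsQF.sum _ (fun i y => l i * bq (σ y i)) fun i _ => (IsQF.of_isAffB (hσ i)).smul (l i)
  have h2 : IsQF (fun y : QReg k => ∑ i, ∑ j, q i j * (2 * bq (σ y i) * bq (σ y j))) :=
    IsQF.sum _ (fun i y => ∑ j, q i j * (2 * bq (σ y i) * bq (σ y j))) fun i _ =>
      IsQF.sum _ (fun j y => q i j * (2 * bq (σ y i) * bq (σ y j))) fun j _ =>
        ((IsQF.of_isAffB (hσ i)).two_mul_mul (IsQF.of_isAffB (hσ j))).smul (q i j)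
  refine (((IsQF.const c).add h1).add h2).congr fun y => ?_
  rw [hp (σ y), Finset.mul_sum]
  congr 1
  refine Finset.sum_congr rfl fun i _ => ?_
  rw [Finset.mul_sum]
  exact Finset.sum_congr rfl fun j _ => by ring

/-! ### Counting the quadratic phase functions on `k` bits: `#QF_k = 4^{k+1} 2^{k(k-1)/2}` -/

/-- The set of quadratic phase functions `𝔽₂ᵏ → ℤ₄`. [folklore] -/
def qfSet (k : ℕ) : Set (QReg k → ZMod 4) := {p | IsQF p}

/-- Membership in `qfSet`. [folklore] -/
theorem mem_qfSet {k : ℕ} {p : QReg k → ZMod 4} : p ∈ qfSet k ↔ IsQF p := Iff.rfl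

/-- On zero bits every function is a (constant) quadratic phase function. [folklore] -/
theorem qfSet_zero : qfSet 0 = Set.univ := by
  ext h
  simp only [mem_qfSet, Set.mem_univ, iff_true]
  refine ⟨h default, 0, 0, fun x => ?_⟩
  rw [Subsingleton.elim x default]
  simp

/-- `#QF_0 = 4`. [folklore] -/
theorem ncard_qfSet_zero : (qfSet 0).ncard = 4 := by
  rw [qfSet_zero, Set.ncard_univ, Nat.card_eq_fintype_card, Fintype.card_fun, ZMod.card,
    Fintype.card_fun, Fintype.card_bool, Fintype.card_fin]
  norm_num

/-- The admissible flip differences on `k` bits: `y ↦ e + 2 Σᵢ [μᵢ][yᵢ]`. [folklore] -/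
def diffFun {k : ℕ} (em : ZMod 4 × (Fin k → ZMod 2)) : QReg k → ZMod 4 :=
  fun y => em.1 + 2 * ∑ i, lift (em.2 i) * bq (y i)

/-- The set of admissible flip differences. [folklore] -/
def diffSet (k : ℕ) : Set (QReg k → ZMod 4) := Set.range (diffFun (k := k))

/-- `2[u] = 2[v] → u = v` on `𝔽₂`. [folklore] -/
theorem eq_of_two_mul_lift_eq : ∀ u v : ZMod 2, 2 * lift u = 2 * lift v → u = v := by decide

/-- The parametrisation of the flip differences is injective. [folklore] -/
theorem diffFun_injective (k : ℕ) : Function.Injective (diffFun (k := k)) := by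
  classical
  rintro ⟨e, μ⟩ ⟨e', μ'⟩ h
  have h0 := congrFun h (fun _ => false)
  simp only [diffFun, bq_false, mul_zero, Finset.sum_const_zero, add_zero] at h0
  subst h0
  simp only [Prod.mk.injEq, true_and]
  funext i
  have hi := congrFun h (fun j => decide (j = i))
  simp only [diffFun, add_right_inj] at hi
  have hsum : ∀ ν : Fin k → ZMod 2, ∑ j, lift (ν j) * bq (decide (j = i)) = lift (ν i) := by
    intro ν
    rw [Finset.sum_eq_single i]
    · simp
    · intro j _ hji
      simp [hji]
    · simp
  rw [hsum, hsum] at hi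
  exact eq_of_two_mul_lift_eq _ _ hi

/-- `#Δ_k = 4 · 2^k`. [folklore] -/
theorem ncard_diffSet (k : ℕ) : (diffSet k).ncard = 4 * 2 ^ k := by
  rw [diffSet, Set.ncard_range_of_injective (diffFun_injective k), Nat.card_prod,
    Nat.card_eq_fintype_card, Nat.card_eq_fintype_card, ZMod.card, Fintype.card_fun, ZMod.card,
    Fintype.card_fin]

/-- Restriction to the face `y_k = 0`. [folklore] -/
def restr {k : ℕ} (h : QReg (k + 1) → ZMod 4) : QReg k → ZMod 4 :=
  fun y => h (Fin.snoc y false)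

/-- The flip difference along the last bit. [folklore] -/
def fdiff {k : ℕ} (h : QReg (k + 1) → ZMod 4) : QReg k → ZMod 4 :=
  fun y => h (Fin.snoc y true) - h (Fin.snoc y false)

/-- Gluing a function on `k` bits and a flip difference into a function on `k + 1` bits.
[folklore] -/
def glue {k : ℕ} (h₀ δ : QReg k → ZMod 4) : QReg (k + 1) → ZMod 4 :=
  fun z => h₀ (Fin.init z) + bq (z (Fin.last k)) * δ (Fin.init z)

/-- The coordinates of `y ↦ (y, b)` are affine. [folklore] -/
theorem isAffB_snoc {k : ℕ} (b : Bool) (i : Fin (k + 1)) :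
    IsAffB (fun y : QReg k => (Fin.snoc y b : QReg (k + 1)) i) := by
  refine Fin.lastCases ?_ (fun j => ?_) i
  · exact (IsAffB.const b).congr fun y => by simp
  · exact (IsAffB.coord j).congr fun y => by simp

/-- The coordinates of `z ↦ init z` are affine. [folklore] -/
theorem isAffB_init {k : ℕ} (i : Fin k) : IsAffB (fun z : QReg (k + 1) => Fin.init z i) :=
  IsAffB.coord (Fin.castSucc i)

/-- The restriction of a quadratic phase function is one. [folklore] -/
theorem isQF_restr {k : ℕ} {h : QReg (k + 1) → ZMod 4} (hh : IsQF h) : IsQF (restr h) :=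
  isQF_comp hh _ (isAffB_snoc false)

/-- The flip difference of a quadratic phase function is admissible (`IsQF.flip_diff`).
[folklore] -/
theorem fdiff_mem {k : ℕ} {h : QReg (k + 1) → ZMod 4} (hh : IsQF h) : fdiff h ∈ diffSet k := by
  classical
  obtain ⟨e₀, m, hflip⟩ := hh.flip_diff (Fin.last k)
  refine ⟨(e₀, fun i => red (m (Fin.castSucc i))), funext fun y => ?_⟩
  have h1 := hflip (Fin.snoc y false)
  rw [Fin.update_snoc_last, Fin.update_snoc_last] at h1
  simp only [diffFun, fdiff]
  rw [h1, Fin.sum_univ_castSucc]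
  simp only [Fin.snoc_castSucc, Fin.snoc_last, bq_false, mul_zero, add_zero]
  congr 1
  rw [Finset.mul_sum, Finset.mul_sum]
  refine Finset.sum_congr rfl fun i _ => ?_
  rw [← mul_assoc, ← mul_assoc, two_mul_eq_two_mul_lift_red (m (Fin.castSucc i))]

/-- `restr ∘ glue`. [folklore] -/
theorem restr_glue {k : ℕ} (h₀ δ : QReg k → ZMod 4) : restr (glue h₀ δ) = h₀ := by
  funext y
  simp [restr, glue, Fin.init_snoc, Fin.snoc_last]

/-- `fdiff ∘ glue`. [folklore] -/
theorem fdiff_glue {k : ℕ} (h₀ δ : QReg k → ZMod 4) : fdiff (glue h₀ δ) = δ := by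
  funext y
  simp [fdiff, glue, Fin.init_snoc, Fin.snoc_last]

/-- A function on `k + 1` bits is glued from its restriction and its flip difference.
[folklore] -/
theorem glue_restr_fdiff {k : ℕ} (h : QReg (k + 1) → ZMod 4) : glue (restr h) (fdiff h) = h := by
  funext z
  simp only [glue, restr, fdiff]
  conv_rhs => rw [← Fin.snoc_init_self z]
  rcases Bool.eq_false_or_eq_true (z (Fin.last k)) with hz | hz
  · rw [hz, bq_true, one_mul, add_sub_cancel]
  · rw [hz, bq_false, zero_mul, add_zero]

/-- Gluing a quadratic phase function and an admissible difference gives a quadratic phase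
function. [folklore] -/
theorem isQF_glue {k : ℕ} {h₀ : QReg k → ZMod 4} (hh₀ : IsQF h₀) (em : ZMod 4 × (Fin k → ZMod 2)) :
    IsQF (glue h₀ (diffFun em)) := by
  classical
  obtain ⟨e, μ⟩ := em
  have h1 : IsQF (fun z : QReg (k + 1) => h₀ (Fin.init z)) := isQF_comp hh₀ _ isAffB_init
  have h2 : IsQF (fun z : QReg (k + 1) => e * bq (z (Fin.last k))) := (IsQF.coord _).smul e
  have h3 : IsQF (fun z : QReg (k + 1) =>
      ∑ i, lift (μ i) * (2 * bq (z (Fin.last k)) * bq (z (Fin.castSucc i)))) :=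
    IsQF.sum _ (fun i z => lift (μ i) * (2 * bq (z (Fin.last k)) * bq (z (Fin.castSucc i))))
      fun i _ => ((IsQF.coord (Fin.last k)).two_mul_mul (IsQF.coord (Fin.castSucc i))).smul (lift (μ i))
  refine ((h1.add h2).add h3).congr fun z => ?_
  have e3 : bq (z (Fin.last k)) * (2 * ∑ i, lift (μ i) * bq (Fin.init z i)) =
      ∑ i, lift (μ i) * (2 * bq (z (Fin.last k)) * bq (z (Fin.castSucc i))) := by
    rw [Finset.mul_sum, Finset.mul_sum]
    exact Finset.sum_congr rfl fun i _ => by simp only [Fin.init]; ring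
  show h₀ (Fin.init z) + e * bq (z (Fin.last k)) +
      ∑ i, lift (μ i) * (2 * bq (z (Fin.last k)) * bq (z (Fin.castSucc i))) =
    h₀ (Fin.init z) + bq (z (Fin.last k)) * (e + 2 * ∑ i, lift (μ i) * bq (Fin.init z i))
  rw [mul_add, e3]
  ring

/-- **Splitting along the last bit** is a bijection `QF_{k+1} ≅ QF_k × Δ_k`. [folklore] -/
theorem image_split_qfSet (k : ℕ) :
    (fun h => (restr h, fdiff h)) '' qfSet (k + 1) = qfSet k ×ˢ diffSet k := by
  ext ⟨h₀, δ⟩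
  simp only [Set.mem_image, Set.mem_prod, mem_qfSet, Prod.mk.injEq]
  constructor
  · rintro ⟨h, hh, rfl, rfl⟩
    exact ⟨isQF_restr hh, fdiff_mem hh⟩
  · rintro ⟨hh₀, ⟨em, rfl⟩⟩
    exact ⟨glue h₀ (diffFun em), isQF_glue hh₀ em, restr_glue _ _, fdiff_glue _ _⟩

/-- The splitting map is injective. [folklore] -/
theorem split_injective (k : ℕ) :
    Function.Injective (fun h : QReg (k + 1) → ZMod 4 => (restr h, fdiff h)) := by
  intro h h' e
  simp only [Prod.mk.injEq] at e
  rw [← glue_restr_fdiff h, ← glue_restr_fdiff h', e.1, e.2]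

/-- The recursion `#QF_{k+1} = #QF_k · 4 · 2^k`. [folklore] -/
theorem ncard_qfSet_succ (k : ℕ) : (qfSet (k + 1)).ncard = (qfSet k).ncard * (4 * 2 ^ k) := by
  rw [← ncard_diffSet, ← Set.ncard_prod, ← image_split_qfSet,
    Set.ncard_image_of_injective _ (split_injective k)]

/-- `C(k+1, 2) = C(k, 2) + k`. [folklore] -/
theorem choose_two_succ (k : ℕ) : (k + 1).choose 2 = k.choose 2 + k := by
  rw [Nat.choose_succ_left _ _ (by norm_num : 0 < 2), Nat.choose_one_right]; ring

/-- **`#QF_k = 4^{k+1} · 2^{k(k-1)/2}`**: a quadratic phase function on `k` bits is given by a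
constant and `k` linear coefficients in `ℤ₄` and `k(k-1)/2` off-diagonal coefficients in `𝔽₂`.
[Dehaene–De Moor 2003, Thm. 5] [folklore] -/
theorem ncard_qfSet (k : ℕ) : (qfSet k).ncard = 4 ^ (k + 1) * 2 ^ (k.choose 2) := by
  induction k with
  | zero => rw [ncard_qfSet_zero]; norm_num
  | succ k ih =>
    rw [ncard_qfSet_succ, ih, choose_two_succ, pow_add, pow_succ 4 (k + 1)]
    ring

/-! ### Supports: affine subspaces cut out by a space of functionals through a point -/

/-- Finiteness of the dual of `𝔽₂ⁿ` (a theorem, used via `haveI`; Mathlib deliberately has no such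
instance). [folklore] -/
theorem finite_dual (n : ℕ) : Finite (Module.Dual (ZMod 2) (V n)) := Module.finite_of_finite (ZMod 2)

/-- The support cut out by the functionals of `Z` through `x₀`: `{x : f(x) = f(x₀) ∀ f ∈ Z}`,
the coset through `x₀` of the subspace `Z^⊥` annihilated by `Z`. [folklore] -/
def supp (Z : Submodule (ZMod 2) (Module.Dual (ZMod 2) (V n))) (x₀ : QReg n) : Set (QReg n) :=
  {x | ∀ f ∈ Z, f (toV x) = f (toV x₀)}

/-- Membership in a support, via the co-annihilator `Z^⊥`. [folklore] -/
theorem mem_supp_iff (Z : Submodule (ZMod 2) (Module.Dual (ZMod 2) (V n))) (x₀ x : QReg n) :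
    x ∈ supp Z x₀ ↔ toV x - toV x₀ ∈ Z.dualCoannihilator := by
  simp only [supp, Set.mem_setOf_eq, Submodule.mem_dualCoannihilator, map_sub, sub_eq_zero]

/-- The base point lies in its support. [folklore] -/
theorem self_mem_supp (Z : Submodule (ZMod 2) (Module.Dual (ZMod 2) (V n))) (x₀ : QReg n) :
    x₀ ∈ supp Z x₀ := fun _ _ => rfl

/-- Supports through two points of one support coincide. [folklore] -/
theorem supp_eq_of_mem {Z : Submodule (ZMod 2) (Module.Dual (ZMod 2) (V n))} {x₀ x₁ : QReg n}
    (h : x₁ ∈ supp Z x₀) : supp Z x₁ = supp Z x₀ := by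
  ext x
  simp only [supp, Set.mem_setOf_eq]
  exact forall₂_congr fun f hf => by rw [h f hf]

/-- A support is the translate of `Z^⊥` through its base point. [folklore] -/
theorem supp_eq_image (Z : Submodule (ZMod 2) (Module.Dual (ZMod 2) (V n))) (x₀ : QReg n) :
    supp Z x₀ = (fun d : V n => ofV (toV x₀ + d)) '' (Z.dualCoannihilator : Set (V n)) := by
  ext x
  rw [mem_supp_iff, Set.mem_image]
  constructor
  · intro h
    exact ⟨toV x - toV x₀, h, by rw [add_sub_cancel, ofV_toV]⟩
  · rintro ⟨d, hd, rfl⟩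
    rwa [toV_ofV, add_sub_cancel_left]

/-- `ofV` is injective. [folklore] -/
theorem ofV_injective : Function.Injective (ofV (n := n)) := fun v w h => by
  rw [← toV_ofV v, h, toV_ofV]

/-- **A support has `2^{dim Z^⊥}` points.** [folklore] -/
theorem ncard_supp (Z : Submodule (ZMod 2) (Module.Dual (ZMod 2) (V n))) (x₀ : QReg n) :
    (supp Z x₀).ncard = 2 ^ finrank (ZMod 2) Z.dualCoannihilator := by
  rw [supp_eq_image, Set.ncard_image_of_injective _ (fun v w h => add_left_cancel (ofV_injective h)),
    ← Nat.card_coe_set_eq, SetLike.coe_sort_coe, Module.natCard_eq_pow_finrank (K := ZMod 2),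
    Nat.card_zmod]

/-- `dim Z + dim Z^⊥ = n`. [folklore] -/
theorem finrank_add_finrank_dualCoannihilator (Z : Submodule (ZMod 2) (Module.Dual (ZMod 2) (V n))) :
    finrank (ZMod 2) Z + finrank (ZMod 2) Z.dualCoannihilator = n := by
  rw [Subspace.finrank_add_finrank_dualCoannihilator_eq, Module.finrank_fin_fun]

/-- **The space of functionals is determined by any one of its supports** (`Z = (Z^⊥)^0`).
[folklore] -/
theorem eq_of_supp_eq {Z Z' : Submodule (ZMod 2) (Module.Dual (ZMod 2) (V n))} {x₀ x₀' : QReg n}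
    (h : supp Z x₀ = supp Z' x₀') : Z = Z' := by
  have hx₀ : x₀ ∈ supp Z' x₀' := h ▸ self_mem_supp Z x₀
  rw [← supp_eq_of_mem hx₀] at h
  have hD : Z.dualCoannihilator = Z'.dualCoannihilator := by
    ext d
    have h1 := Set.ext_iff.1 h (ofV (toV x₀ + d))
    rw [mem_supp_iff, mem_supp_iff, toV_ofV, add_sub_cancel_left] at h1
    exact h1
  rw [← Subspace.dualCoannihilator_dualAnnihilator_eq (W := Z),
    ← Subspace.dualCoannihilator_dualAnnihilator_eq (W := Z'), hD]

/-! ### The quadratic phase functions on a support: `#QF(S) = #QF_{dim S}` -/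

open Classical in
/-- Restriction of a phase function to `S` (zero outside). [folklore] -/
def restrict0 (S : Set (QReg n)) (p : QReg n → ZMod 4) : QReg n → ZMod 4 :=
  fun x => if x ∈ S then p x else 0

open Classical in
/-- Definitional unfolding of `restrict0`. [folklore] -/
theorem restrict0_apply (S : Set (QReg n)) (p : QReg n → ZMod 4) (x : QReg n) :
    restrict0 S p x = if x ∈ S then p x else 0 := rfl

/-- The restrictions to `S` of the quadratic phase functions on `𝔽₂ⁿ`. [folklore] -/
def qfOn (S : Set (QReg n)) : Set (QReg n → ZMod 4) := restrict0 S '' qfSet n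

/-- A linear form followed by `toBool` is an affine Boolean function of the register
(`f(toV x) + c`). [folklore] -/
theorem isAffB_toBool_dual (L : Module.Dual (ZMod 2) (V n)) (c : ZMod 2) :
    IsAffB (fun x : QReg n => ApproxRankTypical.toBool (L (toV x) + c)) := by
  refine IsAffB.of_isAff2 ⟨fun m => L (unitV m), c, fun x => ?_⟩
  dsimp only
  rw [dual_apply_eq_sum, add_comm]
  rfl

/-- **`#QF(S) = 4^{d+1} 2^{d(d-1)/2}` for a support `S` of dimension `d = dim Z^⊥`**: affine
coordinates `𝔽₂ᵈ ≅ S` (a basis of `Z^⊥`) and an affine retraction `𝔽₂ⁿ → 𝔽₂ᵈ` transport the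
restricted quadratic phase functions on `S` bijectively onto `QF_d`. [folklore] -/
theorem ncard_qfOn_supp (Z : Submodule (ZMod 2) (Module.Dual (ZMod 2) (V n))) (x₀ : QReg n) :
    (qfOn (supp Z x₀)).ncard =
      4 ^ (finrank (ZMod 2) Z.dualCoannihilator + 1) * 2 ^ ((finrank (ZMod 2) Z.dualCoannihilator).choose 2) := by
  classical
  set D := Z.dualCoannihilator with hDdef
  set d := finrank (ZMod 2) D with hd
  set S := supp Z x₀ with hS
  let b : Module.Basis (Fin d) (ZMod 2) D := Module.finBasis (ZMod 2) D
  obtain ⟨π, hπ⟩ := LinearMap.exists_leftInverse_of_injective D.subtype (Submodule.ker_subtype D)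
  have hπ' : ∀ m : D, π (m : V n) = m := fun m => by
    have := LinearMap.congr_fun hπ m
    simpa using this
  -- affine coordinates `φ : 𝔽₂ᵈ → S` and an affine retraction `r : 𝔽₂ⁿ → 𝔽₂ᵈ`
  let φ : QReg d → QReg n := fun y => ofV (toV x₀ + ((b.equivFun.symm (toV y) : D) : V n))
  let r : QReg n → QReg d := fun x => ofV (b.equivFun (π (toV x - toV x₀)))
  have hrφ : ∀ y, r (φ y) = y := by
    intro y
    simp only [r, φ, toV_ofV, add_sub_cancel_left, hπ', LinearEquiv.apply_symm_apply, ofV_toV]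
  have hφS : ∀ y, φ y ∈ S := by
    intro y
    rw [hS, mem_supp_iff]
    simp only [φ, toV_ofV, add_sub_cancel_left]
    exact Submodule.coe_mem _
  have hφr : ∀ x ∈ S, φ (r x) = x := by
    intro x hx
    rw [hS, mem_supp_iff] at hx
    have h1 : π (toV x - toV x₀) = ⟨toV x - toV x₀, hx⟩ := hπ' ⟨_, hx⟩
    simp only [φ, r, toV_ofV, LinearEquiv.symm_apply_apply, h1]
    rw [add_sub_cancel, ofV_toV]
  -- both are coordinatewise affine
  have hφaff : ∀ i, IsAffB (fun y => φ y i) := by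
    intro i
    refine IsAffB.of_isAff2 ⟨fun j => ((b j : D) : V n) i, toV x₀ i, fun y => ?_⟩
    simp only [Pi.add_apply, Module.Basis.equivFun_symm_apply, Submodule.coe_sum,
      Submodule.coe_smul, Finset.sum_apply, Pi.smul_apply, smul_eq_mul]
    congr 1
    exact Finset.sum_congr rfl fun j _ => by rw [mul_comm]; rfl
  have hraff : ∀ i, IsAffB (fun x => r x i) := by
    intro i
    let L : Module.Dual (ZMod 2) (V n) :=
      (LinearMap.proj i).comp (b.equivFun.toLinearMap.comp π)
    refine (isAffB_toBool_dual L (-(L (toV x₀)))).congr fun x => ?_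
    show ApproxRankTypical.toBool (L (toV x) + -(L (toV x₀))) =
      ApproxRankTypical.toBool ((b.equivFun (π (toV x - toV x₀))) i)
    rw [map_sub, map_sub, Pi.sub_apply, sub_eq_add_neg]
    rfl
  -- the transport `g ↦ g ∘ φ`
  rw [← ncard_qfSet d]
  refine Set.ncard_congr (fun g _ => fun y => g (φ y)) ?_ ?_ ?_
  · rintro g ⟨G, hG, rfl⟩
    rw [mem_qfSet]
    refine (isQF_comp hG φ hφaff).congr fun y => ?_
    rw [restrict0_apply, if_pos (hφS y)]
  · rintro g g' ⟨G, hG, rfl⟩ ⟨G', hG', rfl⟩ h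
    funext x
    by_cases hx : x ∈ S
    · have := congrFun h (r x)
      simp only [hφr x hx] at this
      exact this
    · rw [restrict0_apply, restrict0_apply, if_neg hx, if_neg hx]
  · intro h hh
    rw [mem_qfSet] at hh
    refine ⟨restrict0 S (fun x => h (r x)), ⟨fun x => h (r x), isQF_comp hh r hraff, rfl⟩, ?_⟩
    funext y
    show restrict0 S (fun x => h (r x)) (φ y) = h y
    rw [restrict0_apply, if_pos (hφS y), hrφ]

/-! ### The stabilizer directions: supports carrying quadratic phases -/

open Classical in
/-- The vector `x ↦ [x ∈ S] · i^{p(x)}`. [folklore] -/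
def stabVec (S : Set (QReg n)) (p : QReg n → ZMod 4) : QReg n → ℂ :=
  fun x => if x ∈ S then phase (p x) else 0

open Classical in
/-- Definitional unfolding of `stabVec`. [folklore] -/
theorem stabVec_apply (S : Set (QReg n)) (p : QReg n → ZMod 4) (x : QReg n) :
    stabVec S p x = if x ∈ S then phase (p x) else 0 := rfl

/-- The support of `stabVec S p` is `S`. [folklore] -/
theorem stabVec_ne_zero_iff (S : Set (QReg n)) (p : QReg n → ZMod 4) (x : QReg n) :
    stabVec S p x ≠ 0 ↔ x ∈ S := by
  rw [stabVec_apply]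
  by_cases h : x ∈ S
  · rw [if_pos h]; exact ⟨fun _ => h, fun _ => phase_ne_zero _⟩
  · rw [if_neg h]; exact ⟨fun h' => absurd rfl h', fun h' => absurd h' h⟩

/-- `stabVec S` only sees the restriction of the phase function to `S`. [folklore] -/
theorem stabVec_restrict0 (S : Set (QReg n)) (p : QReg n → ZMod 4) :
    stabVec S (restrict0 S p) = stabVec S p := by
  funext x
  rw [stabVec_apply, stabVec_apply, restrict0_apply]
  by_cases h : x ∈ S
  · rw [if_pos h, if_pos h, if_pos h]
  · rw [if_neg h, if_neg h]

/-- **The stabilizer directions**: supports `supp Z x₀` carrying quadratic phases. By the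
Dehaene–De Moor normal form and its converse these are, up to non-zero scalars, exactly the
stabilizer states (`lineSet_eq_image`). [folklore] -/
def stabVecs (n : ℕ) : Set (QReg n → ℂ) :=
  {v | ∃ (Z : Submodule (ZMod 2) (Module.Dual (ZMod 2) (V n))) (x₀ : QReg n) (p : QReg n → ZMod 4),
    IsQF p ∧ v = stabVec (supp Z x₀) p}

/-- **The stabilizer lines** `ℂ ψ`, `ψ` a stabilizer state — the set counted by
Aaronson–Gottesman's Proposition 2. [cite: AaronsonGottesman2004, Proposition 2] -/
def lineSet (n : ℕ) : Set (Submodule ℂ (QReg n → ℂ)) := {L | ∃ ψ ∈ stabilizerStates n, L = ℂ ∙ ψ}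

/-- The functional `v ↦ Σ αᵢ vᵢ`. [folklore] -/
def dualOf (α : Fin n → ZMod 2) : Module.Dual (ZMod 2) (V n) := ∑ i, α i • LinearMap.proj i

/-- Evaluation of `dualOf`. [folklore] -/
theorem dualOf_apply (α : Fin n → ZMod 2) (v : V n) : dualOf α v = ∑ i, α i * v i := by
  simp [dualOf, LinearMap.sum_apply, LinearMap.smul_apply, LinearMap.proj_apply]

/-- **A non-empty solution set of affine equations is a support**: the space of functionals is
spanned by the linear parts, the base point is any solution. [folklore] -/
theorem sol_eq_supp {E : List (AffEq n)} {x₀ : QReg n} (hx₀ : Sol E x₀) :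
    {x | Sol E x} = supp (Submodule.span (ZMod 2) {f | ∃ e ∈ E, f = dualOf e.α}) x₀ := by
  ext x
  simp only [Set.mem_setOf_eq, supp]
  constructor
  · intro hx f hf
    have hsub : {f : Module.Dual (ZMod 2) (V n) | ∃ e ∈ E, f = dualOf e.α} ⊆
        (LinearMap.ker (Module.Dual.eval (ZMod 2) (V n) (toV x - toV x₀)) : Set _) := by
      rintro _ ⟨e, he, rfl⟩
      rw [SetLike.mem_coe, LinearMap.mem_ker, Module.Dual.eval_apply, map_sub, sub_eq_zero, dualOf_apply,
        dualOf_apply]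
      have h1 := hx e he
      have h2 := hx₀ e he
      rw [AffEq.eval, add_eq_zero_iff_eq] at h1 h2
      exact h1.trans h2.symm
    have := Submodule.span_le.2 hsub hf
    rwa [LinearMap.mem_ker, Module.Dual.eval_apply, map_sub, sub_eq_zero] at this
  · intro hx e he
    have hf := hx (dualOf e.α) (Submodule.subset_span ⟨e, he, rfl⟩)
    rw [dualOf_apply, dualOf_apply] at hf
    have h2 := hx₀ e he
    rw [AffEq.eval, add_eq_zero_iff_eq] at h2 ⊢
    exact hf.trans h2

/-- **Every stabilizer state is a non-zero multiple of a stabilizer direction** (the tree's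
Dehaene–De Moor normal form `ApproxRankTypical.repr_of_mem_stabilizerStates`).
[Dehaene–De Moor 2003, Thm. 5] [folklore] -/
theorem exists_stabVec_of_mem_stabilizerStates {ψ : QReg n → ℂ} (hψ : ψ ∈ stabilizerStates n) :
    ∃ v ∈ stabVecs n, ∃ c : ℂ, c ≠ 0 ∧ ψ = c • v := by
  obtain ⟨C, hC, rfl⟩ := hψ
  have hne := StabilizerFormalism.mulVec_zeroState_ne_zero hC
  obtain ⟨E, p, c, hp, hEq⟩ := repr_of_mem_stabilizerStates (n := n) ⟨C, hC, rfl⟩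
  have hsol : ∃ x₀, Sol E x₀ := by
    by_contra h
    push Not at h
    apply hne
    rw [hEq]
    funext x
    rw [ddm_apply, if_neg (h x)]
    rfl
  have hc : c ≠ 0 := by
    intro h0
    apply hne
    rw [hEq, h0]
    funext x
    rw [ddm_apply, zero_mul, ite_self]
    rfl
  obtain ⟨x₀, hx₀⟩ := hsol
  set Z : Submodule (ZMod 2) (Module.Dual (ZMod 2) (V n)) :=
    Submodule.span (ZMod 2) {f | ∃ e ∈ E, f = dualOf e.α} with hZ
  refine ⟨stabVec (supp Z x₀) p, ⟨Z, x₀, p, hp, rfl⟩, c, hc, ?_⟩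
  rw [hEq]
  funext x
  rw [ddm_apply, Pi.smul_apply, stabVec_apply, smul_eq_mul]
  have hiff : Sol E x ↔ x ∈ supp Z x₀ := by
    rw [hZ, ← sol_eq_supp hx₀]; rfl
  by_cases hs : Sol E x
  · rw [if_pos hs, if_pos (hiff.1 hs)]
  · rw [if_neg hs, if_neg (fun h => hs (hiff.2 h)), mul_zero]

/-- **Every stabilizer direction is a non-zero multiple of a stabilizer state** (the converse,
`exists_smul_stabilizer_ddm`, applied to the equations `f(x) = f(x₀)`, `f ∈ Z`).
[cite: Vandennest2010, §5 eq. (3) (Conversely)] -/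
theorem exists_smul_stabilizer_of_mem_stabVecs {v : QReg n → ℂ} (hv : v ∈ stabVecs n) :
    ∃ (c : ℂ) (Ψ : QReg n → ℂ), Ψ ∈ stabilizerStates n ∧ c ≠ 0 ∧ v = c • Ψ := by
  classical
  haveI := finite_dual n
  obtain ⟨Z, x₀, p, hp, rfl⟩ := hv
  set T : Finset (Module.Dual (ZMod 2) (V n)) :=
    (Set.toFinite (Z : Set (Module.Dual (ZMod 2) (V n)))).toFinset with hT
  have hTmem : ∀ f, f ∈ T ↔ f ∈ Z := fun f => by rw [hT, Set.Finite.mem_toFinset]; rfl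
  have hsol : ∀ x, Sol (eqsOf T (toV x₀)) x ↔ x ∈ supp Z x₀ := by
    intro x
    rw [sol_eqsOf_iff]
    exact ⟨fun h f hf => h f ((hTmem f).2 hf), fun h f hf => h f ((hTmem f).1 hf)⟩
  have hvec : stabVec (supp Z x₀) p = ddm (eqsOf T (toV x₀)) p 1 := by
    funext x
    rw [stabVec_apply, ddm_apply, one_mul]
    by_cases hx : x ∈ supp Z x₀
    · rw [if_pos hx, if_pos ((hsol x).2 hx)]
    · rw [if_neg hx, if_neg (fun h => hx ((hsol x).1 h))]
  obtain ⟨c, Ψ, hΨ, hc⟩ := exists_smul_stabilizer_ddm (eqsOf T (toV x₀)) hp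
  rw [← hvec] at hc
  have hne : c ≠ 0 := by
    intro h0
    have h1 := congrFun hc x₀
    rw [h0, zero_smul, Pi.zero_apply, stabVec_apply, if_pos (self_mem_supp Z x₀)] at h1
    exact phase_ne_zero _ h1
  exact ⟨c, Ψ, hΨ, hne, hc⟩

/-- **The stabilizer lines are the lines of the stabilizer directions.**
[Dehaene–De Moor 2003, Thm. 5; Van den Nest 2010, §5] [folklore] -/
theorem lineSet_eq_image (n : ℕ) : lineSet n = (fun v => ℂ ∙ v) '' stabVecs n := by
  ext L
  constructor
  · rintro ⟨ψ, hψ, rfl⟩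
    obtain ⟨v, hv, c, hc, rfl⟩ := exists_stabVec_of_mem_stabilizerStates hψ
    exact ⟨v, hv, (Submodule.span_singleton_smul_eq (isUnit_iff_ne_zero.2 hc) v).symm⟩
  · rintro ⟨v, hv, rfl⟩
    obtain ⟨c, Ψ, hΨ, hc, rfl⟩ := exists_smul_stabilizer_of_mem_stabVecs hv
    exact ⟨Ψ, hΨ, Submodule.span_singleton_smul_eq (isUnit_iff_ne_zero.2 hc) Ψ⟩

/-! ### Each line carries exactly four directions: `v, iv, -v, -iv` -/

/-- The four elements of `ℤ₄`. [folklore] -/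
theorem zmod4_cases (d : ZMod 4) : d = 0 ∨ d = 1 ∨ d = 2 ∨ d = 3 := by revert d; decide

/-- `i^d = 1` only for `d = 0` in `ℤ₄`. [folklore] -/
theorem phase_eq_one_iff (d : ZMod 4) : phase d = 1 ↔ d = 0 := by
  refine ⟨fun h => ?_, fun h => by rw [h, phase_zero]⟩
  rcases zmod4_cases d with rfl | rfl | rfl | rfl
  · rfl
  · exfalso
    rw [phase, show (1 : ZMod 4).val = 1 from rfl, pow_one] at h
    have := congrArg Complex.re h
    simp at this
  · exfalso
    rw [phase, show (2 : ZMod 4).val = 2 from rfl, Complex.I_sq] at h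
    have := congrArg Complex.re h
    norm_num at this
  · exfalso
    rw [phase, show (3 : ZMod 4).val = 3 from rfl] at h
    have := congrArg Complex.im h
    simp [pow_succ] at this

/-- `d ↦ i^d` is injective on `ℤ₄`. [folklore] -/
theorem phase_injective : Function.Injective phase := by
  intro a b h
  have h1 : phase (a - b) * phase b = 1 * phase b := by
    rw [one_mul, ← phase_add, sub_add_cancel, h]
  exact sub_eq_zero.1 ((phase_eq_one_iff _).1 (mul_right_cancel₀ (phase_ne_zero b) h1))

/-- `i^{a-b} = i^a / i^b`. [folklore] -/
theorem phase_sub (a b : ZMod 4) : phase (a - b) = phase a * (phase b)⁻¹ := by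
  rw [eq_mul_inv_iff_mul_eq₀ (phase_ne_zero b), ← phase_add, sub_add_cancel]

/-- The directions are closed under the phases `i^j`. [folklore] -/
theorem smul_phase_mem_stabVecs {v : QReg n → ℂ} (hv : v ∈ stabVecs n) (j : ZMod 4) :
    phase j • v ∈ stabVecs n := by
  obtain ⟨Z, x₀, p, hp, rfl⟩ := hv
  refine ⟨Z, x₀, fun x => p x + j, hp.add (IsQF.const j), funext fun x => ?_⟩
  rw [Pi.smul_apply, stabVec_apply, stabVec_apply, smul_eq_mul]
  by_cases h : x ∈ supp Z x₀
  · rw [if_pos h, if_pos h, phase_add, mul_comm]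
  · rw [if_neg h, if_neg h, mul_zero]

/-- **Two directions span the same line iff they differ by a phase `i^j`.** [folklore] -/
theorem exists_eq_phase_smul {v w : QReg n → ℂ} (hv : v ∈ stabVecs n) (hw : w ∈ stabVecs n)
    (h : (ℂ ∙ w) = (ℂ ∙ v)) : ∃ j : ZMod 4, w = phase j • v := by
  have hv' : v ∈ ℂ ∙ w := by rw [h]; exact Submodule.mem_span_singleton_self v
  obtain ⟨a, ha⟩ := Submodule.mem_span_singleton.1 hv'
  obtain ⟨Z, x₀, p, hp, rfl⟩ := hv
  obtain ⟨Z', x₀', p', hp', rfl⟩ := hw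
  have hx₀ := congrFun ha x₀
  rw [Pi.smul_apply, stabVec_apply (supp Z x₀) p x₀, if_pos (self_mem_supp Z x₀), stabVec_apply,
    smul_eq_mul] at hx₀
  have hmem : x₀ ∈ supp Z' x₀' := by
    by_contra hn
    rw [if_neg hn, mul_zero] at hx₀
    exact phase_ne_zero _ hx₀.symm
  rw [if_pos hmem] at hx₀
  have ha0 : a ≠ 0 := by
    rintro rfl
    rw [zero_mul] at hx₀
    exact phase_ne_zero _ hx₀.symm
  refine ⟨p' x₀ - p x₀, ?_⟩
  rw [← ha, smul_smul]
  suffices hs : phase (p' x₀ - p x₀) * a = 1 by rw [hs, one_smul]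
  have hph : phase (p' x₀) ≠ 0 := phase_ne_zero _
  rw [phase_sub, ← hx₀]
  field_simp

/-- **Four directions per line**: `#directions = 4 · #lines`. [folklore] -/
theorem ncard_stabVecs_eq (n : ℕ) : (stabVecs n).ncard = (lineSet n).ncard * 4 := by
  classical
  have hsurj : ∀ L ∈ lineSet n, ∃ v, v ∈ stabVecs n ∧ (ℂ ∙ v) = L := by
    intro L hL
    rw [lineSet_eq_image] at hL
    obtain ⟨v, hv, rfl⟩ := hL
    exact ⟨v, hv, rfl⟩
  choose! rep hrep using hsurj
  have key : stabVecs n =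
      (fun q : Submodule ℂ (QReg n → ℂ) × ZMod 4 => phase q.2 • rep q.1) '' (lineSet n ×ˢ Set.univ) := by
    ext w
    simp only [Set.mem_image, Set.mem_prod, Set.mem_univ, and_true, Prod.exists]
    constructor
    · intro hw
      have hL : (ℂ ∙ w) ∈ lineSet n := by rw [lineSet_eq_image]; exact ⟨w, hw, rfl⟩
      obtain ⟨j, hj⟩ := exists_eq_phase_smul (hrep _ hL).1 hw (hrep _ hL).2.symm
      exact ⟨ℂ ∙ w, j, hL, hj.symm⟩
    · rintro ⟨L, j, hL, rfl⟩
      exact smul_phase_mem_stabVecs (hrep L hL).1 j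
  rw [key, Set.InjOn.ncard_image, Set.ncard_prod, Set.ncard_univ, Nat.card_zmod]
  rintro ⟨L, j⟩ ⟨hL, -⟩ ⟨L', j'⟩ ⟨hL', -⟩ h
  simp only at h
  have hLL' : L = L' := by
    rw [← (hrep L hL).2, ← (hrep L' hL').2,
      ← Submodule.span_singleton_smul_eq (isUnit_iff_ne_zero.2 (phase_ne_zero j)) (rep L), h,
      Submodule.span_singleton_smul_eq (isUnit_iff_ne_zero.2 (phase_ne_zero j'))]
  subst hLL'
  obtain ⟨Z, x₀, p, hp, hv⟩ := (hrep L hL).1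
  have h1 := congrFun h x₀
  rw [hv, Pi.smul_apply, Pi.smul_apply, stabVec_apply, if_pos (self_mem_supp Z x₀), smul_eq_mul,
    smul_eq_mul] at h1
  rw [phase_injective (mul_right_cancel₀ (phase_ne_zero _) h1)]

/-! ### The finite bookkeeping -/

section Count

open Classical

/-- The set of all spaces of functionals on `𝔽₂ⁿ` is finite. [folklore] -/
theorem finite_allZ (n : ℕ) : (Set.univ : Set (Submodule (ZMod 2) (Module.Dual (ZMod 2) (V n)))).Finite := by
  haveI := finite_dual n
  exact Set.toFinite _

/-- All spaces of functionals on `𝔽₂ⁿ`. [folklore] -/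
def allZ (n : ℕ) : Finset (Submodule (ZMod 2) (Module.Dual (ZMod 2) (V n))) := (finite_allZ n).toFinset

/-- Every space of functionals is listed. [folklore] -/
theorem mem_allZ (Z : Submodule (ZMod 2) (Module.Dual (ZMod 2) (V n))) : Z ∈ allZ n := by
  rw [allZ, Set.Finite.mem_toFinset]; exact Set.mem_univ _

/-- The supports of one space of functionals (its cosets). [folklore] -/
def suppsOf (Z : Submodule (ZMod 2) (Module.Dual (ZMod 2) (V n))) : Finset (Set (QReg n)) :=
  Finset.univ.image (supp Z)

/-- All supports (all non-empty affine subspaces of `𝔽₂ⁿ`). [folklore] -/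
def supports (n : ℕ) : Finset (Set (QReg n)) := (allZ n).biUnion suppsOf

/-- The quadratic phase functions on `𝔽₂ⁿ`, as a `Finset`. [folklore] -/
def qfF (n : ℕ) : Finset (QReg n → ZMod 4) := Finset.univ.filter fun p => IsQF p

/-- The quadratic phase functions restricted to `S`, as a `Finset`. [folklore] -/
def qfOnF (S : Set (QReg n)) : Finset (QReg n → ZMod 4) := (qfF n).image (restrict0 S)

/-- The stabilizer directions, as a `Finset`. [folklore] -/
def svF (n : ℕ) : Finset (QReg n → ℂ) := (supports n).biUnion fun S => (qfOnF S).image (stabVec S)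

/-- `qfF` lists `qfSet`. [folklore] -/
theorem coe_qfF (n : ℕ) : (qfF n : Set (QReg n → ZMod 4)) = qfSet n := by
  ext p; simp [qfF, mem_qfSet]

/-- `svF` lists the stabilizer directions. [folklore] -/
theorem mem_svF_iff (v : QReg n → ℂ) : v ∈ svF n ↔ v ∈ stabVecs n := by
  simp only [svF, supports, suppsOf, qfOnF, qfF, Finset.mem_biUnion, Finset.mem_image, Finset.mem_filter,
    Finset.mem_univ, true_and, stabVecs, Set.mem_setOf_eq]
  constructor
  · rintro ⟨S, ⟨Z, _, x₀, rfl⟩, g, ⟨p, hp, rfl⟩, rfl⟩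
    exact ⟨Z, x₀, p, hp, stabVec_restrict0 _ _⟩
  · rintro ⟨Z, x₀, p, hp, rfl⟩
    exact ⟨supp Z x₀, ⟨Z, mem_allZ Z, x₀, rfl⟩, restrict0 (supp Z x₀) p, ⟨p, hp, rfl⟩, stabVec_restrict0 _ _⟩

/-- `#directions = Σ_{supports S} #QF(S)` (distinct supports give distinct vectors; on a fixed
support the vector determines the restricted phase function). [folklore] -/
theorem card_svF (n : ℕ) : (svF n).card = ∑ S ∈ supports n, (qfOnF S).card := by
  rw [svF, Finset.card_biUnion]
  · refine Finset.sum_congr rfl fun S _ => Finset.card_image_of_injOn ?_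
    rintro g hg g' hg' h
    obtain ⟨p, -, rfl⟩ := Finset.mem_image.1 (Finset.mem_coe.1 hg)
    obtain ⟨p', -, rfl⟩ := Finset.mem_image.1 (Finset.mem_coe.1 hg')
    funext x
    have hx := congrFun h x
    rw [stabVec_apply, stabVec_apply] at hx
    rw [restrict0_apply, restrict0_apply]
    by_cases hxS : x ∈ S
    · rw [if_pos hxS, if_pos hxS, restrict0_apply, restrict0_apply, if_pos hxS, if_pos hxS] at hx
      rw [if_pos hxS, if_pos hxS]
      exact phase_injective hx
    · rw [if_neg hxS, if_neg hxS]
  · intro S _ S' _ hne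
    rw [Function.onFun, Finset.disjoint_left]
    rintro v hv hv'
    obtain ⟨g, -, rfl⟩ := Finset.mem_image.1 hv
    obtain ⟨g', -, h⟩ := Finset.mem_image.1 hv'
    apply hne
    ext x
    rw [← stabVec_ne_zero_iff S g x, ← stabVec_ne_zero_iff S' g' x, h]

/-- `#QF(S)` for a listed support. [folklore] -/
theorem card_qfOnF_supp (Z : Submodule (ZMod 2) (Module.Dual (ZMod 2) (V n))) (x₀ : QReg n) :
    (qfOnF (supp Z x₀)).card =
      4 ^ (finrank (ZMod 2) Z.dualCoannihilator + 1) * 2 ^ ((finrank (ZMod 2) Z.dualCoannihilator).choose 2) := by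
  rw [← ncard_qfOn_supp Z x₀, qfOn, ← Set.ncard_coe_finset, qfOnF, Finset.coe_image, coe_qfF]

/-- **Each space of functionals has `2ⁿ / 2^{dim Z^⊥}` supports** (its cosets partition `𝔽₂ⁿ`).
[folklore] -/
theorem card_suppsOf_mul (Z : Submodule (ZMod 2) (Module.Dual (ZMod 2) (V n))) :
    (suppsOf Z).card * 2 ^ finrank (ZMod 2) Z.dualCoannihilator = 2 ^ n := by
  have h := Finset.card_eq_sum_card_image (supp Z) (Finset.univ : Finset (QReg n))
  rw [Finset.card_univ, Fintype.card_fun, Fintype.card_bool, Fintype.card_fin] at h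
  rw [h, suppsOf, Finset.sum_congr rfl (g := fun _ => 2 ^ finrank (ZMod 2) Z.dualCoannihilator),
    Finset.sum_const, smul_eq_mul]
  intro S hS
  obtain ⟨x₁, -, rfl⟩ := Finset.mem_image.1 hS
  have hset : (Finset.univ.filter fun x₀ => supp Z x₀ = supp Z x₁) = (Set.toFinite (supp Z x₁)).toFinset := by
    ext x₀
    simp only [Finset.mem_filter, Finset.mem_univ, true_and, Set.Finite.mem_toFinset]
    exact ⟨fun h => h ▸ self_mem_supp Z x₀, fun h => supp_eq_of_mem h⟩
  rw [hset, ← Set.ncard_eq_toFinset_card _ (Set.toFinite _), ncard_supp]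

/-- Summing over all supports, grouped by their space of functionals. [folklore] -/
theorem sum_supports (F : Set (QReg n) → ℕ) :
    ∑ S ∈ supports n, F S = ∑ Z ∈ allZ n, ∑ S ∈ suppsOf Z, F S := by
  rw [supports, Finset.sum_biUnion]
  intro Z _ Z' _ hne
  rw [Function.onFun, Finset.disjoint_left]
  intro S hS hS'
  obtain ⟨x₀, -, rfl⟩ := Finset.mem_image.1 hS
  obtain ⟨x₀', -, h⟩ := Finset.mem_image.1 hS'
  exact hne (eq_of_supp_eq h).symm

/-- The `j`-graded count of spaces of functionals is the codimension count of
`Literature.LinearAlgebra.Subspace`. [folklore] -/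
theorem card_filter_allZ (j : ℕ) :
    ((allZ n).filter fun Z => finrank (ZMod 2) Z.dualCoannihilator = j).card =
      Nat.card {Y : Submodule (ZMod 2) (Module.Dual (ZMod 2) (V n)) // finrank (ZMod 2) Y + j = n} := by
  rw [← Set.ncard_coe_finset, ← Nat.card_coe_set_eq]
  refine Nat.card_congr (Equiv.subtypeEquivRight fun Y => ?_)
  rw [Finset.mem_coe, Finset.mem_filter]
  simp only [mem_allZ, true_and]
  have := finrank_add_finrank_dualCoannihilator Y
  omega

/-- **The lattice count**: `Σ_Z 2^{C(dim Z^⊥ + 1, 2)} = ∏_{i=1}^{n} (1 + 2^i)`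
(`Literature.LinearAlgebra.Subspace.sum_pow_choose_succ_mul_card_codim`, the `q`-binomial
theorem at `q = z = 2`, in the dual space). [folklore] -/
theorem sum_allZ_pow (n : ℕ) :
    ∑ Z ∈ allZ n, 2 ^ ((finrank (ZMod 2) Z.dualCoannihilator + 1).choose 2) =
      ∏ i ∈ Finset.range n, (1 + 2 ^ (i + 1)) := by
  have hmaps : ∀ Z ∈ allZ n, finrank (ZMod 2) Z.dualCoannihilator ∈ Finset.range (n + 1) := by
    intro Z _
    rw [Finset.mem_range]
    have := finrank_add_finrank_dualCoannihilator Z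
    omega
  rw [← Finset.sum_fiberwise_of_maps_to' hmaps (fun j => 2 ^ ((j + 1).choose 2))]
  simp_rw [Finset.sum_const, smul_eq_mul, card_filter_allZ]
  have h := Literature.LinearAlgebra.Subspace.sum_pow_choose_succ_mul_card_codim
    (k := ZMod 2) (W := Module.Dual (ZMod 2) (V n))
  rw [Subspace.dual_finrank_eq, Module.finrank_fin_fun, Nat.card_zmod] at h
  rw [← h]
  exact Finset.sum_congr rfl fun j _ => by rw [mul_comm]

/-- **`#directions = 4 · 2ⁿ · ∏_{i=1}^{n} (1 + 2^i)`.** [folklore] -/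
theorem card_svF_eq (n : ℕ) : (svF n).card = 4 * 2 ^ n * ∏ i ∈ Finset.range n, (1 + 2 ^ (i + 1)) := by
  rw [card_svF, sum_supports, ← sum_allZ_pow, Finset.mul_sum]
  refine Finset.sum_congr rfl fun Z _ => ?_
  rw [Finset.sum_congr rfl (g := fun _ => 4 ^ (finrank (ZMod 2) Z.dualCoannihilator + 1) *
      2 ^ ((finrank (ZMod 2) Z.dualCoannihilator).choose 2)) fun S hS => by
        obtain ⟨x₀, -, rfl⟩ := Finset.mem_image.1 hS; exact card_qfOnF_supp Z x₀,
    Finset.sum_const, smul_eq_mul]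
  set d := finrank (ZMod 2) Z.dualCoannihilator with hd
  have hdn : d ≤ n := by have := finrank_add_finrank_dualCoannihilator Z; omega
  have hcard : (suppsOf Z).card = 2 ^ (n - d) := by
    have h := card_suppsOf_mul Z
    have h2 : 2 ^ (n - d) * 2 ^ d = 2 ^ n := by rw [← pow_add, Nat.sub_add_cancel hdn]
    exact Nat.eq_of_mul_eq_mul_right (pow_pos two_pos d) (h.trans h2.symm)
  rw [hcard, choose_two_succ, show (4 : ℕ) = 2 ^ 2 from rfl, ← pow_mul, ← pow_add, ← pow_add, ← pow_add,
    ← pow_add]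
  congr 1
  omega

end Count

/-- **Discharge of `AaronsonGottesman2004_prop2`** (Aaronson–Gottesman 2004, Proposition 2: "Let `N`
be the number of pure stabilizer states on `n` qubits. Then `N = 2ⁿ ∏_{k=0}^{n-1} (2^{n-k} + 1)`").
Over the tree's operational `stabilizerStates n` the set of lines `ℂψ` is counted as follows:
by the Dehaene–De Moor normal form (tree) and its converse (`VanDenNest2010_expansion_converse`,
sibling file) the lines are those of the vectors `x ↦ [x ∈ S] i^{p(x)}` with `S` a non-empty
affine subspace and `p` a quadratic phase function, four vectors per line; a `k`-dimensional `S`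
carries `4^{k+1} 2^{k(k-1)/2}` restricted phase functions; summing over the cosets `S` of all
subspaces gives `4 · 2ⁿ Σ_{Z} 2^{C(codim Z + 1, 2)}`, and the lattice-of-subspaces count
(`Literature.LinearAlgebra.Subspace.sum_pow_choose_succ_mul_card_codim`, the `q`-binomial theorem)
evaluates the sum to `∏_{i=1}^{n} (1 + 2^i) = ∏_{k<n} (2^{n-k} + 1)`. (The printed proof counts
stabilizer groups by generating sets of commuting Paulis; the Pauli-stabilizer characterisation,
Theorem 1 (iii)–(iv) of the paper, is not in the tree, whose definition is Theorem 1 (i).)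
[cite: AaronsonGottesman2004, Proposition 2] -/
theorem _root_.Literature.Computability.QuantumComplexity.AaronsonGottesman2004_prop2_holds :
    AaronsonGottesman2004_prop2 := by
  classical
  intro n
  show (lineSet n).ncard = _
  have hsv : stabVecs n = ↑(svF n) := Set.ext fun v => (mem_svF_iff v).symm
  have hprod : ∏ k ∈ Finset.range n, (2 ^ (n - k) + 1) = ∏ i ∈ Finset.range n, (1 + 2 ^ (i + 1)) := by
    rw [← Finset.prod_range_reflect (fun i => 1 + 2 ^ (i + 1)) n]
    refine Finset.prod_congr rfl fun k hk => ?_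
    rw [Finset.mem_range] at hk
    rw [add_comm, show n - 1 - k + 1 = n - k by omega]
  have h4 : (lineSet n).ncard * 4 = (2 ^ n * ∏ k ∈ Finset.range n, (2 ^ (n - k) + 1)) * 4 := by
    rw [← ncard_stabVecs_eq, hsv, Set.ncard_coe_finset, card_svF_eq, hprod]
    ring
  exact Nat.eq_of_mul_eq_mul_right (by norm_num : 0 < 4) h4

end StabilizerNormalForm

end Literature.Computability.QuantumComplexity
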